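import Summits.CriticalPhenomena.Ising3D.Control2DRegionKernel
import Summits.CriticalPhenomena.Ising3D.Control2DPolyCertAuto2
import Mathlib.Tactic.Linarith
import Mathlib.Tactic.Positivity
import HarnessLib

/-!
# Region (R) of a 2D γ-certificate table from SHAPE-ONLY bisection trees (Bernstein decided in the kernel)
(cell `pub-ising3x`, seat controls-1 gen 17; KERNEL PATH for the 2D γ-certificates, Λ ≥ 13 — CONTROL-ONLY scaffolding)

HONEST FRAMING: lottery ticket; floor = tightest certified 3D Ising CFT bounds; no exact-solution
claim without a proof. Nothing numerical about any CFT is asserted here.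

`region_of_kernelCert` (`Control2DRegionKernel`, g16) takes bisection trees whose leaves CARRY the Bernstein
coefficients (`Cert₁` / `Cert₂`, checked by `bernCheck` / `bernCheck₂`). For a Λ = 13 table the compactified
large-`S` polynomial needs ≈ 170 tensor leaves (3.8 MB of literals). Here the trees carry only their SHAPE:
* `Shape₁` / `Shape₂` (leaf | split, resp. leaf | splitO | splitI), `checkAuto₁ p q a L` (leaves decided by
  `bernAuto`, `Control2DPolyCertAuto`) and `checkAuto₂ P n q₁ a₁ L₁ q₂ a₂ L₂` (leaves decided by `bernAuto₂`,
  `Control2DPolyCertAuto2`), with the soundness theorems of `check₁` / `check₂` verbatim;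
* `evalR₂_nonneg_of_qhat_half`: the compactified polynomial need only be checked on `τ ∈ [0,1]`, `v ∈ [0,1]`
  (`v = (x-b)/(x+b) ≥ 0` because `x = b + J ≥ b`) — half the box of `evalR₂_nonneg_of_qhat`, a third of the leaves;
* `checkJsAuto` (per-`J` univariate shapes) and **`region_of_kernelCertAuto`** — hypothesis `hR` of the explicit
  certificate theorems from: the materialised region polynomial `Plit = regPolyZ wt Sl Λ`, its degree bound, its
  materialised compactification `Qlit = qhatZ S₁ d 0 Plit`, ONE shape tree for `Qlit ≥ 0` on `[0,1] × [0,1]` and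
  `S₁ + 1` univariate shapes — every inequality computed and decided by the kernel, no coefficient literals
  (measured: a Λ = 13 table = 49 tensor leaves at ≈ 3.5 s of kernel time each, decided in chunks of ≤ 12 leaves).
Exact mirror: HOME/code/controls/kp4/kmirror2.py (`checkAuto1/2`, `make_shape1/2`). Elementary; no facts. [folklore]
-/

namespace Summit.CriticalPhenomena.Ising3D.Control2D

open Finset
open Literature.Analysis.ValidatedNumerics.PolyMP
open Literature.MathematicalPhysics.QuantumFieldTheory.ConformalBootstrap3D

/-! ### Shape-only bisection trees -/

/-- A univariate bisection shape. [folklore] -/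
inductive Shape₁ : Type
  | leaf : Shape₁
  | split (l r : Shape₁) : Shape₁

/-- Check `p ≥ 0` on `[a/q, (a+L)/q]` along a shape, each leaf by the kernel's Bernstein decision `bernAuto`.
[folklore] -/
def checkAuto₁ (p : List ℤ) : ℤ → ℤ → ℤ → Shape₁ → Bool
  | q, a, L, .leaf => bernAuto p q a L
  | q, a, L, .split l r => checkAuto₁ p (2 * q) (2 * a) L l && checkAuto₁ p (2 * q) (2 * a + L) L r

/-- **Soundness of `checkAuto₁`**: `p(x) ≥ 0` whenever `a ≤ q x ≤ a + L` (`q > 0`, `L ≥ 0`). [folklore] -/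
theorem evalR_nonneg_of_checkAuto₁ (p : List ℤ) : ∀ (C : Shape₁) {q a L : ℤ}, 0 < q → 0 ≤ L →
    checkAuto₁ p q a L C = true → ∀ {x : ℝ}, (a : ℝ) ≤ q * x → (q : ℝ) * x ≤ a + L →
      0 ≤ evalR (castZ p) x
  | .leaf, q, a, L, hq, hL, h, x, h1, h2 => by
      have hqR : (0 : ℝ) < q := by exact_mod_cast hq
      exact evalR_nonneg_of_bernAuto hq hL h (by rw [div_le_iff₀ hqR]; linarith)
        (by rw [le_div_iff₀ hqR]; linarith)
  | .split l r, q, a, L, hq, hL, h, x, h1, h2 => by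
      simp only [checkAuto₁, Bool.and_eq_true] at h
      rcases le_or_gt ((q : ℝ) * x) ((a : ℝ) + (L : ℝ) / 2) with hx | hx
      · exact evalR_nonneg_of_checkAuto₁ p l (by linarith) hL h.1 (by push_cast; linarith)
          (by push_cast; linarith)
      · exact evalR_nonneg_of_checkAuto₁ p r (by linarith) hL h.2 (by push_cast; linarith)
          (by push_cast; linarith)

/-- A bivariate bisection shape (outer / inner splits). [folklore] -/
inductive Shape₂ : Type
  | leaf : Shape₂
  | splitO (l r : Shape₂) : Shape₂
  | splitI (l r : Shape₂) : Shape₂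

/-- Check `P ≥ 0` on `[a₁/q₁, (a₁+L₁)/q₁] × [a₂/q₂, (a₂+L₂)/q₂]` along a shape, each leaf by the kernel's
tensor-Bernstein decision `bernAuto₂` (rows padded to `n`). [folklore] -/
def checkAuto₂ (P : List (List ℤ)) (n : ℕ) : ℤ → ℤ → ℤ → ℤ → ℤ → ℤ → Shape₂ → Bool
  | q₁, a₁, L₁, q₂, a₂, L₂, .leaf => bernAuto₂ P n q₁ a₁ L₁ q₂ a₂ L₂
  | q₁, a₁, L₁, q₂, a₂, L₂, .splitO l r =>
      checkAuto₂ P n (2 * q₁) (2 * a₁) L₁ q₂ a₂ L₂ l && checkAuto₂ P n (2 * q₁) (2 * a₁ + L₁) L₁ q₂ a₂ L₂ r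
  | q₁, a₁, L₁, q₂, a₂, L₂, .splitI l r =>
      checkAuto₂ P n q₁ a₁ L₁ (2 * q₂) (2 * a₂) L₂ l && checkAuto₂ P n q₁ a₁ L₁ (2 * q₂) (2 * a₂ + L₂) L₂ r

/-- **Soundness of `checkAuto₂`**: `P(x, y) ≥ 0` whenever `a₁ ≤ q₁ x ≤ a₁ + L₁`, `a₂ ≤ q₂ y ≤ a₂ + L₂`
(`q₁, q₂ > 0`, `L₁, L₂ ≥ 0`). [folklore] -/
theorem evalR₂_nonneg_of_checkAuto₂ (P : List (List ℤ)) (n : ℕ) : ∀ (C : Shape₂) {q₁ a₁ L₁ q₂ a₂ L₂ : ℤ},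
    0 < q₁ → 0 ≤ L₁ → 0 < q₂ → 0 ≤ L₂ → checkAuto₂ P n q₁ a₁ L₁ q₂ a₂ L₂ C = true →
      ∀ {x y : ℝ}, (a₁ : ℝ) ≤ q₁ * x → (q₁ : ℝ) * x ≤ a₁ + L₁ → (a₂ : ℝ) ≤ q₂ * y →
        (q₂ : ℝ) * y ≤ a₂ + L₂ → 0 ≤ evalR₂ P x y
  | .leaf, q₁, a₁, L₁, q₂, a₂, L₂, hq₁, hL₁, hq₂, hL₂, h, x, y, h1, h2, h3, h4 => by
      have hq₁R : (0 : ℝ) < q₁ := by exact_mod_cast hq₁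
      have hq₂R : (0 : ℝ) < q₂ := by exact_mod_cast hq₂
      exact evalR₂_nonneg_of_bernAuto₂ hq₁ hq₂ hL₁ hL₂ h (by rw [div_le_iff₀ hq₁R]; linarith)
        (by rw [le_div_iff₀ hq₁R]; linarith) (by rw [div_le_iff₀ hq₂R]; linarith)
        (by rw [le_div_iff₀ hq₂R]; linarith)
  | .splitO l r, q₁, a₁, L₁, q₂, a₂, L₂, hq₁, hL₁, hq₂, hL₂, h, x, y, h1, h2, h3, h4 => by
      simp only [checkAuto₂, Bool.and_eq_true] at h
      rcases le_or_gt ((q₁ : ℝ) * x) ((a₁ : ℝ) + (L₁ : ℝ) / 2) with hx | hx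
      · exact evalR₂_nonneg_of_checkAuto₂ P n l (by linarith) hL₁ hq₂ hL₂ h.1 (by push_cast; linarith)
          (by push_cast; linarith) h3 h4
      · exact evalR₂_nonneg_of_checkAuto₂ P n r (by linarith) hL₁ hq₂ hL₂ h.2 (by push_cast; linarith)
          (by push_cast; linarith) h3 h4
  | .splitI l r, q₁, a₁, L₁, q₂, a₂, L₂, hq₁, hL₁, hq₂, hL₂, h, x, y, h1, h2, h3, h4 => by
      simp only [checkAuto₂, Bool.and_eq_true] at h
      rcases le_or_gt ((q₂ : ℝ) * y) ((a₂ : ℝ) + (L₂ : ℝ) / 2) with hy | hy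
      · exact evalR₂_nonneg_of_checkAuto₂ P n l hq₁ hL₁ (by linarith) hL₂ h.1 h1 h2 (by push_cast; linarith)
          (by push_cast; linarith)
      · exact evalR₂_nonneg_of_checkAuto₂ P n r hq₁ hL₁ (by linarith) hL₂ h.2 h1 h2 (by push_cast; linarith)
          (by push_cast; linarith)

/-! ### Small `S`: per-`J` shapes -/

/-- Check the per-`J` univariate shapes, `J = J₀, J₀+1, …`: `zdiagJ J P ≥ 0` on
`b ∈ [max(0, (E₀-J)/2), (S₁-J)/2]` (`a ≤ 2b ≤ a + L`, `a = E₀ ∸ J`, `a + L = S₁ - J`). [folklore] -/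
def checkJsAuto (P : List (List ℤ)) (E₀ S₁ : ℕ) : ℕ → List Shape₁ → Bool
  | _, [] => true
  | J, C :: Cs =>
      checkAuto₁ (zdiagJ J P) 2 ((E₀ - J : ℕ) : ℤ) ((S₁ - J - (E₀ - J) : ℕ) : ℤ) C && checkJsAuto P E₀ S₁ (J + 1) Cs

/-- **Soundness of `checkJsAuto`**: for every listed `J` and every `b ≥ 0` with `E₀ ≤ 2b + J ≤ S₁`,
`P(b + J, b) ≥ 0`. [folklore] -/
theorem evalR₂_nonneg_of_checkJsAuto (P : List (List ℤ)) {E₀ S₁ : ℕ} (hES : E₀ ≤ S₁) :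
    ∀ (Cs : List Shape₁) (J₀ : ℕ), checkJsAuto P E₀ S₁ J₀ Cs = true →
      ∀ J : ℕ, J₀ ≤ J → J < J₀ + Cs.length → ∀ b : ℝ, 0 ≤ b → (E₀ : ℝ) ≤ 2 * b + J →
        2 * b + J ≤ (S₁ : ℝ) → 0 ≤ evalR₂ P (b + J) b
  | [], J₀, _, J, h1, h2, b, _, _, _ => by simp at h2; omega
  | C :: Cs, J₀, h, J, h1, h2, b, hb, hE, hS => by
      simp only [checkJsAuto, Bool.and_eq_true] at h
      rcases Nat.eq_or_lt_of_le h1 with heq | hlt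
      · subst heq
        have hJS : J₀ ≤ S₁ := by exact_mod_cast (show (J₀ : ℝ) ≤ S₁ by linarith)
        rw [← evalR_zdiagJ]
        refine evalR_nonneg_of_checkAuto₁ _ C (by norm_num) (by positivity) h.1 ?_ ?_
        · rcases le_total J₀ E₀ with hle | hge
          · push_cast [Nat.cast_sub hle]; linarith
          · rw [Nat.sub_eq_zero_of_le hge]; push_cast; linarith
        · have hsum : ((E₀ - J₀) + (S₁ - J₀ - (E₀ - J₀)) : ℕ) = S₁ - J₀ := by omega
          have hcast : (((E₀ - J₀ : ℕ) : ℤ) : ℝ) + (((S₁ - J₀ - (E₀ - J₀) : ℕ) : ℤ) : ℝ) =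
              (S₁ : ℝ) - J₀ := by
            rw [show (((E₀ - J₀ : ℕ) : ℤ) : ℝ) + (((S₁ - J₀ - (E₀ - J₀) : ℕ) : ℤ) : ℝ) =
                (((E₀ - J₀) + (S₁ - J₀ - (E₀ - J₀)) : ℕ) : ℝ) by push_cast; ring, hsum,
              Nat.cast_sub hJS]
          rw [hcast]; push_cast; linarith
      · exact evalR₂_nonneg_of_checkJsAuto P hES Cs (J₀ + 1) h.2 J hlt (by simp at h2 ⊢; omega) b hb hE hS

/-! ### Large `S`: only `v ≥ 0` is needed -/

/-- **Large `S` from the compactified polynomial on the HALF box**: if `Q̂ ≥ 0` on `[0,1] × [0,1]` then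
`P(x, b) ≥ 0` for all real `0 ≤ b ≤ x` with `x + b ≥ S₁` (`S₁ > 0`; `v = (x-b)/(x+b) ∈ [0,1]`). [folklore] -/
theorem evalR₂_nonneg_of_qhat_half (P : List (List ℤ)) {S₁ : ℕ} (d : ℕ) (hS₁ : 0 < S₁)
    (hdeg : degOK d 0 P = true)
    (hQ : ∀ τ v : ℝ, 0 ≤ τ → τ ≤ 1 → 0 ≤ v → v ≤ 1 → 0 ≤ evalR₂ (qhatZ S₁ d 0 P) τ v)
    {x b : ℝ} (hb : 0 ≤ b) (hbx : b ≤ x) (hS : (S₁ : ℝ) ≤ x + b) : 0 ≤ evalR₂ P x b := by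
  have hS₁R : (0 : ℝ) < S₁ := by exact_mod_cast hS₁
  have hSpos : 0 < x + b := lt_of_lt_of_le hS₁R hS
  have h := hQ ((S₁ : ℝ) / (x + b)) ((x - b) / (x + b)) (by positivity)
    (by rw [div_le_one hSpos]; exact hS)
    (div_nonneg (by linarith) hSpos.le) (by rw [div_le_one hSpos]; linarith)
  rw [evalR₂_qhatZ S₁ d hSpos P 0 hdeg, pow_zero, one_mul] at h
  have hc : (0 : ℝ) < (2 * (S₁ : ℝ) / (x + b)) ^ d := by positivity
  exact (mul_nonneg_iff_of_pos_left hc).mp h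

/-! ### Assembly -/

/-- **The region obligation (R) of a 2D γ-certificate at `(1/2,1/2)`, `Δ_σ = 1/8`, from shape-only kernel
data.** As `region_of_kernelCert`, with the materialised compactification `Qlit = qhatZ S₁ d 0 Plit`, a tensor
tree `C : Shape₂` for `Qlit ≥ 0` on the half box `[0,1] × [0,1]` checked by `checkAuto₂`, and the `S₁ + 1` per-`J`
shapes by `checkJsAuto`: for all real `b ≥ 0` and `J ∈ ℕ` with `2b + J ≥ E₀`, hypothesis `hR` of
`gapExcluded_half_of_explicit(N)` / `excludedOn_half_of_explicit(N)` verbatim. PROVED. [folklore] -/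
theorem region_of_kernelCertAuto (wt : ℕ × ℕ → ℤ) {Sl : List (ℕ × ℕ)} (hnd : Sl.Nodup) {Λ : ℕ}
    (hΛ : ∀ p ∈ Sl, p.1 + p.2 ≤ Λ) {E₀ S₁ : ℕ} (d n : ℕ) (hES : E₀ ≤ S₁) (hS₁ : 0 < S₁)
    {Plit : List (List ℤ)} (hP : regPolyZ wt Sl Λ = Plit) (hdeg : degOK d 0 Plit = true)
    {Qlit : List (List ℤ)} (hQl : qhatZ S₁ d 0 Plit = Qlit)
    (C : Shape₂) (hQ : checkAuto₂ Qlit n 1 0 1 1 0 1 C = true)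
    (Cs : List Shape₁) (hlen : Cs.length = S₁ + 1) (hJ : checkJsAuto Plit E₀ S₁ 0 Cs = true) :
    ∀ (b : ℝ) (J : ℕ), 0 ≤ b → (E₀ : ℝ) ≤ 2 * b + J →
      0 ≤ ∑ p ∈ Sl.toFinset, (wt p : ℝ) * ((1 - (-1 : ℝ) ^ (p.1 + p.2)) * 2 ^ (p.1 + p.2) *
        (qFactor₁ (1 / 8) (b + J) p.1 * qFactor₁ (1 / 8) b p.2 +
          qFactor₁ (1 / 8) b p.1 * qFactor₁ (1 / 8) (b + J) p.2)) := by
  intro b J hb hE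
  have hJ0 : (0 : ℝ) ≤ J := Nat.cast_nonneg J
  have key : 0 ≤ evalR₂ Plit (b + J) b := by
    rcases le_or_gt (S₁ : ℝ) (2 * b + J) with hbig | hsmall
    · refine evalR₂_nonneg_of_qhat_half Plit d hS₁ hdeg ?_ (x := b + J) hb (by linarith) (by linarith)
      intro τ v h0 h1 h2 h3
      rw [hQl]
      exact evalR₂_nonneg_of_checkAuto₂ _ n C (by norm_num) (by norm_num) (by norm_num) (by norm_num) hQ
        (by push_cast; linarith) (by push_cast; linarith) (by push_cast; linarith)
        (by push_cast; linarith)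
    · have hJle : J ≤ S₁ := by exact_mod_cast (show (J : ℝ) ≤ S₁ by linarith)
      exact evalR₂_nonneg_of_checkJsAuto Plit hES Cs 0 hJ J (Nat.zero_le _) (by rw [hlen]; omega) b hb hE
        hsmall.le
  rw [← hP, evalR₂_regPolyZ wt hnd hΛ] at key
  exact (mul_nonneg_iff_of_pos_left (regConst_pos Λ)).mp key

end Summit.CriticalPhenomena.Ising3D.Control2D
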